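import Mathlib
import HarnessLib
import HarnessLib.Audit
import Summits.QuantumAdvantage.Statement
import Literature.Computability.Complexity.Oracle
import Literature.Computability.MetaComplexity.MCSP
import Literature.Computability.Cryptography.ClassBQP

/-!
Route: InverterDequantization

CLOSED (retired) 2026-08-16T03:03:33Z by planner-rchoice-QuantumAdvantage-InverterDequa-ccbc3234-0 — reason: route-choice (bridge-only hold, operator 2026-08-16T02:41Z): option (b) retire — the bridge's named condition MCSPMemBPP (MCSP ∈ BPP) is believed FALSE by opener, reviewer and grounder, so it cannot honestly be promoted to a staffed crux, a — note: route-choice (planner rchoice-ccbc3234): RETIRE, not 'add MCSPMemBPP as a crux'. (1) MCSPMemBPP = MCSP ∈ BPP is believed FALSE by the opener ('never a proving target'), the route reviewer (refuter d39967b4: 'a conditional bridge whose hypothesis the route itself believes false can never deliver ¬Qua. The file is kept as the record of this route; refuted decls are indexed as negative knowledge (`ledger negatives`).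

Route InverterDequantization (realises idea card
QuantumAdvantage/QuantumAdvantage/inverter-dequantization). NEGATIVE SIDE: the assembly targets
¬QuantumAdvantage; explicit CONDITIONAL BRIDGE on item MCSPMemBPP ("MCSP ∈ BPP", the
no-one-way-function world; believed FALSE and carried as a named hypothesis, never as a proving
target).
THESIS X (= item XNeg, words): language-level quantum advantage is nothing but INVERSION POWER —
every BQP language is decidable in probabilistic polynomial time with an oracle for the Minimum
Circuit Size Problem: BQP ⊆ BPP^MCSP. An MCSP oracle (equivalently for this purpose R_KT / MKTP, any
dense set of KT-random strings) is a UNIVERSAL AVERAGE-CASE INVERTER of polynomial-time functions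
for EVERY input length (AllenderEtAl2006 Thm 45 = HILL + GGM + Razborov–Rudich; restated with oracle
MCSP as AllenderDas2017 Thm 1), and under any inverter the hidden-subgroup witnesses collapse
classically — factoring and DLOG (AllenderEtAl2006 Thm 46–47) and graph isomorphism (AllenderDas2017
Thm 2) in print, general white-box coset functions over finite black-box groups (and, with
box-sampling, the ℤ^k-periodic Pell / class-group functions) by the one-paragraph coset-section
lemma (item CosetSectionUniform: x ↦ x⁻¹·Inv(f(x)) pushes the uniform law of G to the uniform law of
the hidden H, because Inv(f(x)) depends on the coset only; support-grade, not yet in print in this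
generality). X says the collapse is total: no BQP language survives a universal inverter.
Lean (one line over existing decls; elaborates rc 0 in the planner's Sketch.lean):
`Literature.Computability.Cryptography.BQP ⊆ Literature.Computability.Complexity.BPPRel
(Literature.Computability.Complexity.Oracle.ofLanguage
Literature.Computability.MetaComplexity.MCSP)`.
IT SUFFICES (frame): #0 X = XNeg; #1 Assembly := XNeg → MCSPMemBPP → BPPSelfLow → ¬QuantumAdvantage
— if MCSP ∈ BPP then BPP^MCSP = BPP (Ko 1982: BPP is low for itself, item BPPSelfLow, provable now
over the tree's OracleBPPAmplification), hence BQP ⊆ BPP and no L ∈ BQP ∖ BPP exists (pure logic;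
proved by a 3-line term in the sketch). Read contrapositively X is the sharpest PREREQUISITE of its
shape for the summit: X ⟹ (QuantumAdvantage → MCSP ∉ BPP), i.e. decision advantage needs
meta-complexity / cryptographic hardness — strengthening "BQP ⊆ PH ⟹ (P = NP ⟹ BQP = BPP)"
(Aaronson, arXiv:0910.4698 §1 p.4) from NP-oracles down to one NP-intermediate inverter oracle.
THE TEST (item KummerSectorMCSP, crux rank 3): the first natural BQP-language candidate that is NOT
visibly an inversion/HSP problem — the cubic Gauss-sum (Kummer) sector of the sibling card
kummer-sector-language, in BQP by van Dam–Seroussi phase estimation modulo g(χ)³ = p·J(χ,χ) — is it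
in BPP^MCSP? A proof folds Gauss-sum angles back into "inversion" (evidence for X); a conditional
refutation exhibits the first inversion-free decision advantage and kills X.

CONDITIONAL on MCSPMemBPP — this route is an explicit reduction to that named conjecture (D-0019: crux floor waived).

Rationale: WHY THIS LINE. The hub's negative side so far has one object to shoot at (route Dequantize:
polynomial stabilizer rank). This route adds a second, STRUCTURAL one imported from meta-complexity:
instead of simulating circuits gate by gate, ask what ORACLE POWER language-level advantage amounts
to. Every promise-free witness candidate on the hub's positive routes (Shor: FACT; AvgCase:
DLOGHalf; PadKuperberg's vectorization is a hidden SHIFT, same coset mechanism) is an instance of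
coset sampling, and coset sampling dies under a universal inverter (AllenderEtAl2006 Thm 44–47, read
in the held FOCS'02 text pp.22–25; AllenderDas2017 Thm 1–3 for the MCSP oracle, read pp.5–7); the
thesis XNeg = BQP ⊆ BPP^MCSP says this is the whole story for LANGUAGES (sampling/promise advantage
— Forrelation, Jones, RCS — is untouched). Imported areas: meta-complexity and Kolmogorov/KT theory
(MCSP, R_KT: AllenderEtAl2006, AllenderDas2017, Hirahara2018), foundations of cryptography
(HastadImpagliazzoLevinLuby1999, GGM, RazborovRudich1997), finite group theory (coset-section
lemma), and — for the test only — cubic Gauss/Jacobi sums (VanDamSeroussi2002 §5, §8; Ireland–Rosen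
Prop 8.3.3/§9.4: g(χ)³ = p·J(χ,χ)). Why MCSP and not "¬OWF": Impagliazzo–Luby inverters from ¬OWF
work only infinitely often, Thm 45 inverts at EVERY length, so the inclusion is clean; MCSP (in the
tree) replaces the card's MKTP (not in the tree) at no loss (ABK+06 §4.2: "all our hardness results
for R_KT also hold for MCSP"). No physical analogy is used.
RANKED CRUXES (3) + 2 support + assembly (6 items; thin by design).
 rank 2 XNeg [crux, hypothesis-grade structural thesis]: BQP ⊆ BPP^MCSP. Why it might fail:
Aaronson's conjecture BQP ⊄ PH (XNeg forces BQP ⊆ BPP^NP ⊆ Σ₃∩Π₃); relativized it is false (Raz–Tal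
BQP^O ⊄ PH^O; AaronsonIngramKretschmer2022: an oracle with P = NP ≠ BQP, where MCSP^O ∈ NP^O = P^O),
so a proof must be non-relativizing and consume the Clifford+T gate list of `BQP`; no proof idea
beyond HSP is in hand (honest).
 rank 3 KummerSectorMCSP [crux, the adjudication test; typed inline over Mathlib]: the cubic
Gauss-sum sector language {⟨p,r,k⟩ : p ≡ 1 (3) prime, r a primitive root, arg(g(χ_{p,r})·ω^{-k}) ∈
(−π/3, π/3]} is in BPP^MCSP. It is a CONSEQUENCE of XNeg once KummerSector ∈ BQP lands (sibling card
kummer-sector-language K1, van Dam–Seroussi), and the cheapest place where XNeg can be tested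
outside HSP: side conditions (primality, primitive root via factoring p−1 ∈ ZPP^MCSP, J(χ,χ) =
primary prime via Cornacchia) are classical relative to MCSP; only the sector is open. Why it might
fail: the sector may be an archimedean/metaplectic invariant with no coset structure for Thm 45 to
bite on (vDS §8 ask exactly "hard even if factoring and DLOG are easy?").
 rank 5 MCSPMemBPP [crux, hypothesis-type CONDITIONAL — refuters/provers: do not staff]: MCSP ∈ BPP.
Believed FALSE (any one-way function refutes it via Thm 45; KabanetsCai2000; natural proofs vs
PRFs), unprovable either way today (MCSP ∉ BPP ⟹ NP ⊄ BPP). It is the price of reaching ¬S from a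
structural thesis; every negative-side route pays such a price (Dequantize: polynomial stabilizer
rank).
 support BPPSelfLow (Ko1982; provable now from OracleBPPAmplification/bpErr machinery: amplify the
oracle language to error 2^{-q(n)}, answer the ≤ q(n) queries with fresh coins, union bound, then
bp∘bp = bp).
 support CosetSectionUniform (the K1 core, provable now over Mathlib: for f hiding H ≤ G by left
cosets and ANY g : α → G, on the success set S = {x | f(g(f x)) = f x} the map x ↦ x⁻¹ g(f x) hits
each h ∈ H exactly |S|/|H| times).
 assembly: XNeg → MCSPMemBPP → BPPSelfLow → ¬QuantumAdvantage (pure logic, rc 0 with proof term in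
Sketch.lean).
KILL CRITERIA. (a) KummerSectorMCSP refuted under a standard assumption while KummerSector ∈ BQP
lands ⟹ first inversion-free decision advantage ⟹ XNeg dead in spirit: close
`refuted:KummerSectorMCSP` (the negatives entry is itself valuable: it certifies the Kummer witness
as NOT crypto-flavoured). (b) An unconditional theorem "XNeg ⟹ PH collapses / ⟹ P = NP-type
consequence" stronger than BQP ⊆ BPP^NP ⟹ close exhausted with census. (c) BPPSelfLow or
CosetSectionUniform false AS TYPED ⟹ restate (never a kill). Nothing short of the summit refutes
XNeg outright; nothing short of ¬OWF proves MCSPMemBPP — both said plainly above.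
NOT DECOMPOSED YET (deliberately, D-0019): K1 at complexity level — "white-box coset functions over
black-box groups with unique encoding: generators of H in FZPP^MCSP", and its typed instances FACT ∈
ZPP^MCSP, DLOGHalf ∈ BPP^MCSP (ABK+06 Thm 46–47 need Thm 45 as a NAMED FACT: cite item filed; HILL
is not formalisation-sized); the generation lemma (⌈log₂|H|⌉+k uniform elements generate H w.p. ≥
1−2^{-k}) rides with --supports CosetSectionUniform; ℤ^k/continuous periods (Pell) need box-sampling
error terms; XNeg ⟹ BQP ⊆ BPP^NP as a separate consequence item; the iO-language of card
hidden-spread-forrelation as a second test; ℓ-th order sectors and metaplectic theta coefficients. A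
named Literature definition `KummerSector` is requested so this route's K3 and the sibling card's
route can share one decl.
NOVELTY / BARRIERS: see the dedicated sections (searched before claiming; nearest prior art
AllenderEtAl2006 Thm 45–47, AllenderDas2017, arXiv:0910.4698 §1; barriers Relativization /
Algebrization / SupremacyTheoremsNonRelativizing apply to XNeg and are NOT evaded — XNeg is
hypothesis-grade; SeparationPrerequisites gains a conditional new prerequisite).
SOURCES: AllenderEtAl2006 (doi:10.1137/050628994), AllenderDas2017 (doi:10.1016/j.ic.2017.04.004),
KabanetsCai2000, HastadImpagliazzoLevinLuby1999, RazborovRudich1997, Ko1982, Hirahara2018,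
RazTal2022, AaronsonIngramKretschmer2022, FortnowRogers1999JCSS, arXiv:0910.4698, VanDamSeroussi2002
(arXiv:quant-ph/0207131), ImpagliazzoLuby1989, CarmosinoImpagliazzoKabanetsKolokolova2016,
arXiv:2410.00499, arXiv:2410.04984.

Novelty: NOVELTY (searched BEFORE claiming, 2026-08-15: card audit by
refuter-novelty-audit-QuantumAdvantage-QuantumAdvantage-2-0 (grade new-combination; read FOCS'02
text of doi:10.1137/050628994 Thms 46-47, grepped arXiv:2108.03171, read arXiv:0910.4698 p.3,
arXiv:2111.10409 pp.5-6, crossref OW-puzzle query); this planner: `lit read doi:10.1137/050628994`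
pp.22-25 (Thm 44 HILL, Thm 45 universal inversion for every n, Thm 46 DLOG ∈ BPP^{R_KT}, Thm 47
Factoring ∈ ZPP^{R_KT}, p.22/p.24 "all our hardness results for R_KT also hold for MCSP"), `lit read
doi:10.1016/j.ic.2017.04.004` pp.5-7 (Thm 1 = Thm 45 with L = co-MCSP[2^{n/2}], Thm 2 GI ∈ RP^MCSP,
Thm 3 SZK ⊆ Promise-BPP^MCSP), `lit read arxiv:0910.4698` p.3 L62-68 ("entirely possible that ...
all languages in BQP are nevertheless in PH") and p.4 L24-34 (P = NP vs BQP), `lit read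
arxiv:2111.10409` p.2 (oracle with P = NP ≠ BQP = P^#P), `lit search "MCSP oracle BQP quantum"`
(local: arXiv:2410.04984, arXiv:2108.03171, arXiv:2103.09320 — none states an oracle dequantization
of BQP; remote OpenAlex/S2/arXiv 429, crossref 12 irrelevant), `lit search --hybrid "hidden subgroup
problem solved classically given an oracle inverting one-way functions"` (8 book hits, none
relevant), `lit galaxy search "oracle access to MCSP" --star pdf` (1 hit: Ilango CCC'20,
search-to-decision for formulas, unrelated), `lit galaxy search "BQP is contained in BPP with an
oracle for MCSP" --star all` (0), `lit frontier QuantumAdvantage --since 2020` and `lit bri  [refs: 10.1137/050628994, 10.1137/050628994`, 10.1016/j.ic.2017.04.004`, 10.1016/j.ic.2017.04.004, 10.1007/978-3-662-44465-8_3, 2108.03171, 0910.4698, 2111.10409, 2410.04984, 2103.09320, 2602.17647, 2410.00499, quant-ph/0207131, doi:10.1137/050628994, doi:10.1016/j.ic.2017.04.004, arxiv:0910.4698, arxiv:2111.10409, doi:10.1007/978-3-662-44465-8_3, AllenderEtAl2006, AllenderDas2017, VanDamSeroussi2002]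

Barriers (technique_class: meta-complexity, inversion-oracles, conditional-bridge): BARRIERS (technique_class: meta-complexity, inversion-oracles, conditional-bridge — negative side,
structural). Negatives index `ledger negatives --problem QuantumAdvantage`: 0 refuted statements —
nothing to avoid.
Literature.Barriers.QuantumAdvantage.Relativization: APPLIES to XNeg and is NOT evaded —
relativized, XNeg is false: Raz–Tal give BQP^O ⊄ PH^O (RazTal2022; tree: OracleSeparationBQPPH), and
AaronsonIngramKretschmer2022 (arXiv:2111.10409 p.2) an oracle with P = NP ≠ BQP = P^#P, under which
MCSP^O ∈ NP^O = P^O so BPP^{MCSP^O} = BPP^O ⊉ BQP^O; by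
Relativization.not_relativizes_collapse_shape a proof of XNeg (a collapse-shape inclusion composed
with MCSPMemBPP) must be non-relativizing, i.e. must consume the Clifford+T gate list of `BQP`
white-box. The route carries XNeg as a hypothesis-grade crux and says so; the earned items
(CosetSectionUniform, BPPSelfLow, Assembly) are inclusions/lemmas that relativize harmlessly.
Literature.Barriers.QuantumAdvantage.Algebrization: same status —
Algebrization.not_isAlgebrizingInclusion_bqp_bpp (AaronsonWigderson2009 §5) excludes algebrizing
proofs of the collapse BQP ⊆ BPP that XNeg + MCSPMemBPP would yield; not evaded; no arithmetization
is proposed; the bet is white-box use of the gate set (none in hand).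
Literature.Barriers.QuantumAdvantage.SupremacyTheoremsNonRelativizing: FortnowRogers1999JCSS Thm
4.1/4.2 (OWF ∧ P = BQP relative to an oracle) make the template "OWF ⟹ BPP ≠ BQP" non-relativizing;
this route studies the CONVER

History (route lifecycle, newest last):
- 2026-08-16T03:03:33Z · CLOSED retired — route-choice (bridge-only hold, operator 2026-08-16T02:41Z): option (b) retire — the bridge's named condition MCSPMemBPP (MCSP ∈ BPP) is believed FALSE by opener, reviewer and grounder, so it cannot h (planner-rchoice-QuantumAdvantage-InverterDequa-ccbc3234-0)

sub-problem: QuantumAdvantage · status: closed(retired) · opened planner-plancard-QuantumAdvantage-QuantumAdva-8abe7f78-0 2026-08-15T10:57:39Z · rev 1 · ledger route-QuantumAdvantage-InverterDequantization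
GENERATED by the gate from the ledger (D-0016/17). Provers cite these decls: `theorem foo : Summit.QuantumAdvantage.QuantumAdvantage.Theses.InverterDequantization.<Decl> := …` in Summits/QuantumAdvantage/QuantumAdvantage/Theorems/<Name>.lean.
-/

namespace Summit.QuantumAdvantage.QuantumAdvantage.Theses.InverterDequantization

open scoped BigOperators Topology Manifold Classical MeasureTheory ProbabilityTheory Matrix InnerProductSpace ComplexConjugate ContinuousMap
open Filter Set Function TopologicalSpace MeasureTheory

attribute [summit_statement] _root_.QuantumAdvantage
-- H21.Audit: conditional_on 'MCSPMemBPP' is not an accepted declaration — no route_premise tag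

open Literature.QuantumAdvantage

/-- item stmt-QuantumAdvantage-1606 · crux · rank 2 · closed · moot by None · by planner
why it might fail: XNeg forces BQP ⊆ BPP^NP ⊆ PH (3rd level), against Aaronson's conjecture BQP ⊄ PH; relativized it is FALSE (Raz–Tal BQP^O ⊄ PH^O; AIK22 Thm 10: oracle with P = NP ≠ BQP, so BPP^{MCSP^O} = P^O ⊉ BQP^O): a proof must be non-relativizing, white-box in the gate set; no idea beyond HSP instances exists.
sources: AllenderEtAl2006 Thm 44-47 (doi:10.1137/050628994; FOCS'02 text pp.22-25: Thm 45 universal a.e. inversion, Thm 46 DLOG ∈ BPP^RKT, Thm 47 Factoring ∈ ZPP^RKT, p.22 'all our hardness results for RKT also hold for MCSP'), AllenderDas2017 Thm 1-3 (doi:10.1016/j.ic.2017.04.004: GI ∈ RP^MCSP, SZK ⊆ Promise-BPP^MCSP), arXiv:0910.4698 §1 pp.3-4 (Aaronson, BQP and the polynomial hierarchy: 'we must also seek evidence that BQP ⊄ PH'; 'if P = NP? If BQP ⊆ PH then …'), RazTal2022 (tree: Literature.Computability.QuantumComplexity.OracleSeparationBQPPH, exists_oracle_BQPRel_not_subset_PHRel_of),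 AaronsonIngramKretschmer2022 Thm 10 (arXiv:2111.10409 p.9: oracle with P = NP ≠ BQP = P^#P), FortnowRogers1999JCSS Thm 4.1/4.2
[crux] THESIS X_neg (hypothesis-grade structural thesis, negative side): BQP ⊆ BPP^MCSP — every
language decided with error ≤ 1/3 by a P-uniform Clifford+T family
(Literature.Computability.Cryptography.BQP) is in bp(P^MCSP) =
Literature.Computability.Complexity.BPPRel (Oracle.ofLanguage MCSP), MCSP = Kabanets–Cai's Minimum
Circuit Size Problem over the basis B2 (Literature.Computability.MetaComplexity.MCSP). Meaning: an
MCSP oracle is a UNIVERSAL AVERAGE-CASE INVERTER — for every f(y,x) computable in time poly(|x|)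
there is a PPT oracle machine N^MCSP with Pr_{|x|=n,s}[f(y, N(y, f(y,x), s)) = f(y,x)] ≥ 1/q(n) for
EVERY n and y (AllenderEtAl2006 Thm 45 via HILL Thm 44 + GGM + Razborov–Rudich; with oracle MCSP:
ABK+06 §4.2 p.24 'all our hardness results for R_KT also hold for MCSP', AllenderDas2017 Thm 1 with
L = {tt f : (f, 2^{n/2}) ∉ MCSP}); hence DLOG ∈ BPP^MCSP, Factoring ∈ ZPP^MCSP (Thm 46-47), GI ∈
RP^MCSP and SZK ⊆ Promise-BPP^MCSP (AllenderDas2017 Thm 2-3), and by the coset-section lemma (item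
CosetSectionUniform) every white-box hidden-subgroup witness dies. X_neg claims the collapse is
total for LANGUAGES: decision advantage = inversion power (sampling/promise advantage unt -/
@[route_item "route-QuantumAdvantage-InverterDequantization"]
def XNeg : Prop :=
  Literature.Computability.Cryptography.BQP ⊆ Literature.Computability.Complexity.BPPRel (Literature.Computability.Complexity.Oracle.ofLanguage Literature.Computability.MetaComplexity.MCSP)

/-- item stmt-QuantumAdvantage-1607 · crux · rank 3 · closed · moot by None · by planner
why it might fail: The sector (which cube root of pπ is g(χ)) is archimedean: π = J(χ,χ) and residue symbols are classical but no real place of ℚ(ω) ties them to arg g; Thm 45 inverts only poly-time maps, none known to encode the sector (Matthews: (p−1)/3 factors; HB–Patterson: equidistributed; vDS p.12: open).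
sources: VanDamSeroussi2002 §5 Alg.1/Thm 1 and §8 p.12 (arXiv:quant-ph/0207131: 'important open question if Gauss sum estimation is hard classically, even under the assumption that factoring and discrete logarithms are easy'), IrelandRosen1990 Ch.9 §12 pp.137-138 of the held 1982 ed. (Kummer's problem: g(χ_π) determined only up to 1, ω, ω²; Prop 8.3.3-8.3.4, §9.4 Lemma 1 Cor.: g(χ_π)^3 = pπ), Matthews1979 (doi:10.1007/bf01403063: Cassels' elliptic-function formula for the Kummer sum, (p−1)/3 factors), HeathBrownPatterson1979 (doi:10.1515/crll.1979.310.111: arguments of cubic Gauss sums equidistributed), AllenderEtAl2006 Thm 45-47 (doi:10.1137/050628994: what an MCSP/RKT oracle does give — inversion, DLOG, factoring, hence the side conditions primality/primitive root are in ZPP^MCSP), idea card QuantumAdvantage/QuantumAdvantage/kummer-sector-language (sibling route-QuantumAdvantage-KummerSector)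
[crux] THE TEST (adjudication item shared in spirit with the sibling card kummer-sector-language;
typed inline over Mathlib until a Literature def `KummerSector` lands). Input ⟨p, r, k⟩ = boolPair
(encodeNat p) (boolPair (encodeNat r) (encodeNat k)); conditions: p prime, p ≡ 1 (mod 3), r a
primitive root mod p (IsPrimitiveRoot (r : ZMod p) (p-1)), k < 3. Let u = r^{(p-1)/3} ∈ F_p (a
primitive cube root of 1), ω = e^{2πi/3}, and χ = χ_{p,r} the cubic character with χ(r) = ω: χ(a) =
0, 1, ω, ω² according as a = 0, a^{(p-1)/3} = 1, = u, = u². g(χ) = Σ_{a<p} χ(a) e^{2πi a/p} is the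
cubic Gauss sum (|g| = √p, g³ = p·J(χ,χ), J(χ,χ) = the primary prime π of ℤ[ω] above p with χ = χ_π:
Ireland–Rosen 8.3.3-8.3.4, 9.4). So g = ω^k·ρ for a unique k ∈ {0,1,2}, ρ the principal cube root of
pπ; the language asks for that k, written without J as 'arg(g·ω^{-k}) ∈ (−π/3, π/3]' (boundaries are
never hit: arg ρ = ±π/3 would force pπ real, impossible). CLAIM TO DECIDE: this language is in
BPP^MCSP. Context: (i) it is in BQP modulo van Dam–Seroussi (estimate arg g to ±π/7 by phase
estimation on |χ⟩ = (p−1)^{-1/2} Σ χ(a)|a⟩, an eigenvector of a χ-twisted Fourier operator with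
eigenvalue g/√p (vDS Alg. 1 -/
@[route_item "route-QuantumAdvantage-InverterDequantization"]
def KummerSectorMCSP : Prop :=
  ({w : List Bool | ∃ p r k : ℕ, w = Literature.Computability.Complexity.boolPair (Computability.encodeNat p) (Literature.Computability.Complexity.boolPair (Computability.encodeNat r) (Computability.encodeNat k)) ∧ p.Prime ∧ p % 3 = 1 ∧ IsPrimitiveRoot (r : ZMod p) (p - 1) ∧ k < 3 ∧ Complex.arg ((Finset.range p).sum (fun a : ℕ => (if (a : ZMod p) = 0 then (0 : ℂ) else if (a : ZMod p) ^ ((p - 1) / 3) = 1 then (1 : ℂ) else if (a : ZMod p) ^ ((p - 1) / 3) = (r : ZMod p) ^ ((p - 1) / 3) then Complex.exp (2 * Real.pi * Complex.I / 3) else Complex.exp (2 * Real.pi * Complex.I / 3) ^ 2) * Complex.exp (2 * Real.pi * Complex.I * a / p)) * (Complex.exp (2 * Real.pi * Complex.I / 3))⁻¹ ^ k) ∈ Set.Ioc (-(Real.pi / 3)) (Real.pi / 3)} : Language Bool) ∈ Literature.Computability.Complexity.BPPRel (Literature.Computability.Complexity.Oracle.ofLanguage Literature.Computability.MetaCompl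exity.MCSP)

/-- item stmt-QuantumAdvantage-1608 · support · rank 5 · closed · moot by None · by planner
why it might fail: Believed FALSE: MCSP ∈ BPP makes every poly-time function invertible on average at every length (AllenderEtAl2006 Thm 45; KabanetsCai2000), i.e. no one-way functions; an unconditional refutation would be NP ⊄ BPP, hence P ≠ NP. Hypothesis of the bridge only — never a proving target.
sources: KabanetsCai2000 §2 (MCSP; consequences of MCSP ∈ P), AllenderEtAl2006 Thm 45 (doi:10.1137/050628994 p.23; p.22: 'if MCSP is in P then there is a randomized polynomial-time algorithm that factors arbitrary integers'), RazborovRudich1997, HastadImpagliazzoLevinLuby1999 Thm 1.1, CarmosinoImpagliazzoKabanetsKolokolova2016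
[crux] THE NAMED CONDITIONAL of this bridge (hypothesis-type — provers and refuters: DO NOT STAFF;
it is here so that the assembly is honest and machine-checked). MCSP ∈ BPP = 'the natural property
of having large circuit complexity is BPP-constructive', equivalently (via ABK+06 Thm 45 and HILL) a
world with a universal average-case inverter in BPP and hence NO one-way functions, NO pseudorandom
generators, and efficient learning of P/poly-concepts from the natural property (CIKK 2016) —
Impagliazzo's Algorithmica/Heuristica/Pessiland side. It is believed FALSE. Its role: Assembly =
XNeg → MCSPMemBPP → BPPSelfLow → ¬QuantumAdvantage, i.e. 'no inversion hardness ⟹ no quantum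
DECISION advantage'. Read contrapositively with XNeg: QuantumAdvantage ⟹ MCSP ∉ BPP (a new
separation prerequisite of cryptographic flavour). MCSP replaces the card's MKTP (not in the tree)
at no loss for this purpose. -/
@[route_item "route-QuantumAdvantage-InverterDequantization"]
def MCSPMemBPP : Prop :=
  Literature.Computability.MetaComplexity.MCSP ∈ Literature.Computability.Complexity.BPP

/-- item stmt-QuantumAdvantage-1609 · support · rank 9 · closed · moot by None · by planner
sources: Ko1982, doi:10.1016/0020-0190(82)90139-9, AroraBarakCC2009 §7.4.1 (error reduction), tree: Literature/Computability/Complexity/OracleBPPAmplification.lean (bpErr_PRel_subset_BPPRel), BPClosureProofs.lean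
[support] BPP IS LOW FOR ITSELF (Ko 1982; Zachos 1983): for every A ∈ BPP, BPP^A ⊆ BPP, in the
tree's operator form BPPRel (Oracle.ofLanguage A) = bp (PRel (ofLanguage A)) ⊆ bp P. Provable now:
given L ∈ bp(P^A) with witness L' ∈ P^A (machine M, query bound q), replace each of the ≤ poly many
oracle answers by a run of an amplified BPP machine for A with error ≤ 2^{-2q(n)} on fresh coins
(BPP error reduction, OracleBPPAmplification / bpErr machinery), union-bound over the queries to get
a P-machine with two coin blocks deciding L with error ≤ 1/3 + o(1) → amplify once more; i.e.
bp∘(P^{bp P}) ⊆ bp∘bp P = bp P. The assembly needs exactly this glue: XNeg ∧ MCSP ∈ BPP ⟹ BQP ⊆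
BPP^MCSP ⊆ BPP. Independently reusable library fact (e.g. for any route that removes a BPP-decidable
oracle). -/
@[route_item "route-QuantumAdvantage-InverterDequantization"]
def BPPSelfLow : Prop :=
  ∀ A : Language Bool, A ∈ Literature.Computability.Complexity.BPP → Literature.Computability.Complexity.BPPRel (Literature.Computability.Complexity.Oracle.ofLanguage A) ⊆ Literature.Computability.Complexity.BPP

/-- item stmt-QuantumAdvantage-1610 · support · rank 9 · closed · moot by None · by planner
sources: doi:10.1137/050628994 Thm 46-47 (the cyclic instances), doi:10.1016/j.ic.2017.04.004 Thm 2 (GI instance), folklore: coset sampling in the hidden subgroup problem (Lomont arXiv:quant-ph/0411037 §2)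
[support] THE COSET-SECTION LEMMA (core of the card's K1 'HSP dies under a universal inverter'; pure
finite group theory, provable now over Mathlib). Let G be a finite group, H ≤ G, f : G → α hiding H
by LEFT cosets (f x = f y ↔ x⁻¹y ∈ H), and g : α → G ANY function (an inverter that may fail). On
the success set S = {x | f(g(f x)) = f x} — a union of left cosets, since g(f x) depends on the
coset xH only — the map x ↦ x⁻¹·g(f x) lands in H and hits every h ∈ H exactly |S|/|H| times: #{x ∈
S | x⁻¹ g(f x) = h}·|H| = |S|. Proof: on a successful coset C with section value s = g(f(C)) ∈ C, x
↦ x⁻¹s is a bijection C → H. CONSEQUENCE (K1, to be typed when black-box-group/HSP vocabulary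
lands): with the MCSP inverter of ABK+06 Thm 45 (success ≥ 1/q(n) over uniform x and coins, success
checkable because f is white-box), uniform x ∈ G conditioned on success yields a UNIFORM element of
H; ⌈log₂|H|⌉ + k such samples generate H except with probability ≤ 2^{-k} (generation lemma, rides
with --supports), so generators of every white-box hidden subgroup over a black-box group with
unique encodings are computable in FZPP^MCSP, abelian or not — factoring (order finding), DLOG,
Simon/Shor-type perio -/
@[route_item "route-QuantumAdvantage-InverterDequantization"]
def CosetSectionUniform : Prop :=
  ∀ (G : Type) [Group G] [Finite G] (H : Subgroup G) (α : Type) (f : G → α) (g : α → G), (∀ x y : G, f x = f y ↔ x⁻¹ * y ∈ H) → ∀ h ∈ H, Nat.card {x : G // f (g (f x)) = f x ∧ x⁻¹ * g (f x) = h} * Nat.card H = Nat.card {x : G // f (g (f x)) = f x}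

/-- item stmt-QuantumAdvantage-1611 · assembly · rank 1 · closed · moot by None · by planner
sources: Summits/QuantumAdvantage/QuantumAdvantage/Statement.lean (QuantumAdvantage := ∃ L, L ∈ BQP ∧ L ∉ BPP)
[assembly] XNeg → MCSPMemBPP → BPPSelfLow → ¬QuantumAdvantage: given L ∈ BQP with L ∉ BPP (the
summit's witness), XNeg puts L in BPP^MCSP, BPPSelfLow applied to MCSP ∈ BPP puts BPP^MCSP inside
BPP — contradiction. Pure logic (3-line term checked rc 0 in the planner's Sketch.lean: `fun hX hM
hLow ⟨L, hQ, hB⟩ => hB (hLow _ hM (hX hQ))`). Note BPP ⊆ BQP is NOT needed for the negation of the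
existential summit form. -/
@[route_item "route-QuantumAdvantage-InverterDequantization"]
def Assembly : Prop :=
  XNeg → MCSPMemBPP → BPPSelfLow → ¬ QuantumAdvantage

end Summit.QuantumAdvantage.QuantumAdvantage.Theses.InverterDequantization
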